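import Literature.NumberTheory.EllipticCurves.PotentialGoodReductionLegendreProofs
import Literature.NumberTheory.EllipticCurves.LegendreFormGoodModelProofs
import Literature.NumberTheory.EllipticCurves.LegendreFormValuation
import Mathlib.FieldTheory.IsAlgClosed.Basic
import HarnessLib

/-!
# [IUTchIV] Proposition 1.8 (vi), first sentence, in real form: rational `2`-torsion ⇒ a Legendre
# model over `k` (the `j`-invariant of a curve with split `2`-division cubic is a Legendre `j`)

`Proofs` file (theorems only; no definitions, no named facts, no instances) in topic
`NumberTheory/EllipticCurves`, companion of `PotentialGoodReductionLegendreProofs`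
(`b_c_Δ_eq_of_roots_eq`: `c₄ = 16(σ₁² − 3σ₂)`, `Δ = 16∏(eᵢ − eⱼ)²` when the `2`-division cubic
`4x³ + b₂x² + 2b₄x + b₆` has roots `e₁, e₂, e₃`), `LegendreFormValuation` (`legendre_c₄`,
`legendre_Δ`) and `LegendreFormGoodModelProofs` (`legendre_isElliptic_iff`, `legendre_j_mul`).
Written by the cell `abc-iut` (seat abc-iut-L5-t12) as the REAL form, for Weierstrass equations, of
the first sentence of

> S. Mochizuki, *Inter-universal Teichmüller theory IV*, Prop. 1.8 (vi) (kurims Apr-2020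
> manuscript, p. 19): "In the situation of (iii), suppose further that `2` is invertible in `k`,
> that `G_E = G_k`, and that the representation `G_E → Aut(E_k̄[2])` is trivial. Then `E_k̄`
> descends to an elliptic curve `E_k` over `k` which is defined by means of the Legendre form of
> the Weierstrass equation."

used in [IUTchIV] Thm. 1.10 (p. 22: "`F_tpd := F_mod(E_{F_mod}[2])` … a model `E_{F_tpd}` of the
elliptic curve `E_F ×_F F̄` over `F_tpd` determined by the Legendre form of the Weierstrass equation
[cf. … Proposition 1.8, (vi)]") and Cor. 2.2 (ii) (p. 42). Classical content: Silverman *AEC*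
III.1.7 ("Legendre form") and its proof. In Weierstrass-equation terms: if the `2`-division cubic
of an elliptic curve `W` over `k` (characteristic `0`) splits over `k` with roots `e₁, e₂, e₃` —
equivalently, the three points of order `2` of `W(k̄)` are `k`-rational — then
`λ := (e₃ − e₁)/(e₂ − e₁) ∈ k ∖ {0, 1}` and `j(W) = j(y² = x(x − 1)(x − λ))`, so that the Legendre
curve `⟨0, −(1 + λ), 0, λ, 0⟩`, DEFINED OVER `k`, is a `k`-model of `W_k̄` (Mathlib
`exists_variableChange_of_j_eq` over `k̄`; and it is even a `k`-FORM of `W` as soon as both have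
`k`-rational `3`-torsion, by Prop. 1.8 (iv) in real form, `TorsionRationalDescentProofs`).

## Main results

* `algebraMap_j_eq_legendre_j_of_roots_eq` — roots `e₁, e₂, e₃ ∈ L ⊇ k` of the `2`-division cubic
  ⇒ `λ ≠ 0, 1` and `j(W) = j(Legendre λ)` in `L` (pure algebra: both equal
  `256 (σ₁² − 3σ₂)³ / ∏(eᵢ − eⱼ)²`).
* `j_eq_legendre_j_of_roots_eq` — the case `L = k`.
* `exists_two_torsion_point_of_mem_roots` — a root `e` of the `2`-division cubic is the abscissa of
  the point `(e, −(a₁e + a₃)/2)` of order `2` (Silverman *AEC* III.2.3(d)).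
* `exists_legendre_j_eq_of_two_torsion_rational` — **Prop. 1.8 (vi), first sentence**: if every
  point of order `2` of `W(K̄)` (`K̄ ⊇ k` algebraically closed) is `k`-rational, then
  `∃ λ ∈ k ∖ {0,1}` with `j(W) = j(Legendre λ)`.

## References

* [Mochizuki2012] S. Mochizuki, IUT IV, Prop. 1.8 (vi) p. 19 (proof p. 20: "[Harts] IV Prop. 4.6");
  Thm. 1.10 p. 22; Cor. 2.2 p. 42.
* [SilvermanAEC2009] J. H. Silverman, *The Arithmetic of Elliptic Curves*, 2nd ed.: III.§1
  (`b`-, `c`-invariants), Prop. III.1.7 and its proof, III.2.3(d) (points of order `2`).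

## Design

Pure theorems, characteristic `0` throughout (the cell's consumers are number fields; the tree's
`b_c_Δ_eq_of_roots_eq` is stated under `CharZero`). The Legendre curve is written as the literal
`⟨0, −(1 + λ), 0, λ, 0⟩` of the tree's Legendre files; its ellipticity is produced as an
existential witness (`∃ _ : (…).IsElliptic, …`) as in `exists_legendre_j_eq`. Axioms: `propext`,
`Classical.choice`, `Quot.sound`.
-/

noncomputable section

open scoped Classical

universe u v

namespace WeierstrassCurve

open Literature.NumberTheory.EllipticCurves Polynomial

/-! ## §1. The `j`-invariant of a curve with split `2`-division cubic is a Legendre `j` -/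

section Algebra

variable {k : Type u} {L : Type v} [Field k] [Field L] [CharZero L] [Algebra k L]
  (W : WeierstrassCurve k) [W.IsElliptic]

/-- `jΔ = c₄³` for an elliptic Weierstrass equation (Silverman *AEC* III.§1; private copy of the
tree's `InertiaInvariantsMultiplicativeProofs.j_mul_Δ_eq_c₄_pow`, to keep the imports light).
[folklore] -/
private theorem jΔ_eq_c₄_cube_aux : W.j * W.Δ = W.c₄ ^ 3 := by
  have hΔ0 : W.Δ ≠ 0 := by rw [← coe_Δ']; exact W.Δ'.ne_zero
  rw [WeierstrassCurve.j, Units.val_inv_eq_inv_val, coe_Δ', mul_comm, ← mul_assoc,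
    mul_inv_cancel₀ hΔ0, one_mul]

/-- **Roots of the `2`-division cubic are distinct** for an elliptic curve in characteristic `0`
(`Δ = 16∏(eᵢ − eⱼ)² ≠ 0`). [cite: SilvermanAEC2009, Prop. III.1.7 (proof)] -/
theorem roots_ne_of_roots_eq {e₁ e₂ e₃ : L}
    (h3 : (Cubic.map (algebraMap k L) W.twoTorsionPolynomial).roots = {e₁, e₂, e₃}) :
    e₁ ≠ e₂ ∧ e₁ ≠ e₃ ∧ e₂ ≠ e₃ := by
  have ha : W.twoTorsionPolynomial.a ≠ 0 := by
    haveI : CharZero k := RingHom.charZero (algebraMap k L)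
    show (4 : k) ≠ 0
    norm_num
  refine (Cubic.discr_ne_zero_iff_roots_ne ha h3).mp ?_
  rw [twoTorsionPolynomial_discr]
  haveI : CharZero k := RingHom.charZero (algebraMap k L)
  exact mul_ne_zero (by norm_num) W.Δ'.ne_zero

/-- **`j(W) = j(Legendre λ)`, `λ = (e₃ − e₁)/(e₂ − e₁)`**, when the `2`-division cubic
`4x³ + b₂x² + 2b₄x + b₆` of the elliptic curve `W/k` has roots `e₁, e₂, e₃` in an extension `L`
(characteristic `0`): then `λ ≠ 0, 1`, the Legendre equation `y² = x(x − 1)(x − λ)` is elliptic,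
and its `j`-invariant `2⁸(λ² − λ + 1)³/(λ²(λ − 1)²)` equals `j(W)` — both are
`256 (σ₁² − 3σ₂)³ / ((e₁ − e₂)(e₁ − e₃)(e₂ − e₃))²` (tree: `b_c_Δ_eq_of_roots_eq`, `legendre_c₄`,
`legendre_Δ`). Silverman *AEC* Prop. III.1.7 and its proof (`x = (e₂ − e₁)x′ + e₁`).
[cite: SilvermanAEC2009, Prop. III.1.7 (proof)] -/
theorem algebraMap_j_eq_legendre_j_of_roots_eq {e₁ e₂ e₃ : L}
    (h3 : (Cubic.map (algebraMap k L) W.twoTorsionPolynomial).roots = {e₁, e₂, e₃}) :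
    (e₃ - e₁) / (e₂ - e₁) ≠ 0 ∧ (e₃ - e₁) / (e₂ - e₁) ≠ 1 ∧
      ∃ _ : (⟨0, -(1 + (e₃ - e₁) / (e₂ - e₁)), 0, (e₃ - e₁) / (e₂ - e₁), 0⟩ :
          WeierstrassCurve L).IsElliptic,
        algebraMap k L W.j =
          (⟨0, -(1 + (e₃ - e₁) / (e₂ - e₁)), 0, (e₃ - e₁) / (e₂ - e₁), 0⟩ : WeierstrassCurve L).j := by
  obtain ⟨h12, h13, h23⟩ := W.roots_ne_of_roots_eq h3
  have hd : e₂ - e₁ ≠ 0 := sub_ne_zero.mpr (Ne.symm h12)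
  have hp : e₃ - e₁ ≠ 0 := sub_ne_zero.mpr (Ne.symm h13)
  have hq : e₃ - e₂ ≠ 0 := sub_ne_zero.mpr (Ne.symm h23)
  have h2 : (2 : L) ≠ 0 := two_ne_zero
  set la : L := (e₃ - e₁) / (e₂ - e₁) with hla
  have hla0 : la ≠ 0 := div_ne_zero hp hd
  have hla1 : la ≠ 1 := by
    intro h
    rw [hla, div_eq_one_iff_eq hd] at h
    exact hq (by linear_combination h)
  have hla1' : la - 1 ≠ 0 := sub_ne_zero.mpr hla1
  haveI hV : (⟨0, -(1 + la), 0, la, 0⟩ : WeierstrassCurve L).IsElliptic :=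
    (legendre_isElliptic_iff h2 la).mpr ⟨hla0, hla1⟩
  refine ⟨hla0, hla1, hV, ?_⟩
  set V : WeierstrassCurve L := ⟨0, -(1 + la), 0, la, 0⟩ with hVdef
  -- `W` side: `j·Δ = c₄³` with `c₄ = 16 S`, `Δ = 16 D²`
  obtain ⟨-, -, -, hc₄, hΔ⟩ := b_c_Δ_eq_of_roots_eq (W := W) h3
  set S : L := (e₁ + e₂ + e₃) ^ 2 - 3 * (e₁ * e₂ + e₁ * e₃ + e₂ * e₃) with hS
  set D : L := (e₁ - e₂) * (e₁ - e₃) * (e₂ - e₃) with hD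
  have hD0 : D ≠ 0 := mul_ne_zero (mul_ne_zero (sub_ne_zero.mpr h12) (sub_ne_zero.mpr h13))
    (sub_ne_zero.mpr h23)
  have hWj : algebraMap k L W.j * (16 * D ^ 2) = (16 * S) ^ 3 := by
    rw [← hΔ, ← hc₄, ← map_pow, ← map_mul, W.jΔ_eq_c₄_cube_aux]
  -- Legendre side: `j·(16λ²(λ−1)²) = (16(λ²−λ+1))³`
  have hVj : V.j * (16 * la ^ 2 * (la - 1) ^ 2) = (16 * (la ^ 2 - la + 1)) ^ 3 := by
    rw [← legendre_Δ la, ← legendre_c₄ la]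
    exact V.jΔ_eq_c₄_cube_aux
  have h16 : (16 : L) ≠ 0 := by norm_num
  have eW : algebraMap k L W.j = (16 * S) ^ 3 / (16 * D ^ 2) :=
    eq_div_of_mul_eq (mul_ne_zero h16 (pow_ne_zero _ hD0)) hWj
  have eV : V.j = (16 * (la ^ 2 - la + 1)) ^ 3 / (16 * la ^ 2 * (la - 1) ^ 2) :=
    eq_div_of_mul_eq (mul_ne_zero (mul_ne_zero h16 (pow_ne_zero _ hla0)) (pow_ne_zero _ hla1'))
      hVj
  rw [eW, eV, hla, hS, hD]
  rw [div_eq_div_iff (mul_ne_zero h16 (pow_ne_zero _ hD0))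
    (mul_ne_zero (mul_ne_zero h16 (pow_ne_zero _ (by rwa [hla] at hla0)))
      (pow_ne_zero _ (by rwa [hla] at hla1')))]
  field_simp
  ring

/-- The case `L = k`: if the `2`-division cubic of the elliptic curve `W/k` (characteristic `0`)
has its three roots in `k`, then `λ := (e₃ − e₁)/(e₂ − e₁) ∈ k ∖ {0, 1}` and
`j(W) = j(y² = x(x − 1)(x − λ))` — a Legendre curve DEFINED OVER `k` with the `j`-invariant of `W`
(Silverman *AEC* III.1.7). [cite: SilvermanAEC2009, Prop. III.1.7 (proof)] -/
theorem j_eq_legendre_j_of_roots_eq [CharZero k] {e₁ e₂ e₃ : k}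
    (h3 : (Cubic.map (algebraMap k k) W.twoTorsionPolynomial).roots = {e₁, e₂, e₃}) :
    (e₃ - e₁) / (e₂ - e₁) ≠ 0 ∧ (e₃ - e₁) / (e₂ - e₁) ≠ 1 ∧
      ∃ _ : (⟨0, -(1 + (e₃ - e₁) / (e₂ - e₁)), 0, (e₃ - e₁) / (e₂ - e₁), 0⟩ :
          WeierstrassCurve k).IsElliptic,
        W.j = (⟨0, -(1 + (e₃ - e₁) / (e₂ - e₁)), 0, (e₃ - e₁) / (e₂ - e₁), 0⟩ : WeierstrassCurve k).j := by
  simpa only [Algebra.algebraMap_self_apply] using W.algebraMap_j_eq_legendre_j_of_roots_eq h3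

end Algebra

/-! ## §2. Roots of the `2`-division cubic are abscissae of points of order `2` -/

section TwoTorsion

variable {K : Type u} [Field K] [CharZero K] (V : WeierstrassCurve K) [V.IsElliptic]

/-- **A root of the `2`-division cubic is the abscissa of a point of order `2`**: if
`4e³ + b₂e² + 2b₄e + b₆ = 0` then `P := (e, −(a₁e + a₃)/2)` lies on the (elliptic, characteristic
`0`) curve, `P = −P`, and `2P = O` (Silverman *AEC* III.2.3(d): the points of order `2` are those
with `ψ₂ = 2y + a₁x + a₃ = 0`, and `ψ₂² = 4(x³ + a₂x² + a₄x + a₆) + (a₁x + a₃)²` on the curve).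
[cite: SilvermanAEC2009, III.2.3(d)] -/
theorem exists_two_torsion_point_of_mem_roots {e : K} (he : e ∈ V.twoTorsionPolynomial.roots) :
    ∃ (y : K) (h : V.toAffine.Nonsingular e y),
      (2 : ℤ) • (Affine.Point.some e y h : V.toAffine.Point) = 0 := by
  have ha : V.twoTorsionPolynomial.a ≠ 0 := by show (4 : K) ≠ 0; norm_num
  have h0 : V.twoTorsionPolynomial.toPoly ≠ 0 := Cubic.ne_zero_of_a_ne_zero ha
  have hroot := (Cubic.mem_roots_iff h0 e).mp he
  simp only [twoTorsionPolynomial] at hroot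
  -- `hroot : 4 * e ^ 3 + b₂ * e ^ 2 + 2 * b₄ * e + b₆ = 0`
  set y : K := -(V.a₁ * e + V.a₃) / 2 with hy
  have h2 : (2 : K) ≠ 0 := two_ne_zero
  have hy2 : 2 * y = -(V.a₁ * e + V.a₃) := by rw [hy]; field_simp
  have heq : V.toAffine.Equation e y := by
    rw [Affine.equation_iff']
    change y ^ 2 + V.a₁ * e * y + V.a₃ * y - (e ^ 3 + V.a₂ * e ^ 2 + V.a₄ * e + V.a₆) = 0
    have hb₂ : V.b₂ = V.a₁ ^ 2 + 4 * V.a₂ := rfl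
    have hb₄ : V.b₄ = 2 * V.a₄ + V.a₁ * V.a₃ := rfl
    have hb₆ : V.b₆ = V.a₃ ^ 2 + 4 * V.a₆ := rfl
    rw [hb₂, hb₄, hb₆] at hroot
    have h4 : (4 : K) * (y ^ 2 + V.a₁ * e * y + V.a₃ * y - (e ^ 3 + V.a₂ * e ^ 2 + V.a₄ * e + V.a₆))
        = 0 := by
      linear_combination (-1 : K) * hroot + (2 * y + (V.a₁ * e + V.a₃)) * hy2
    exact (mul_eq_zero.mp h4).resolve_left (by norm_num)
  have hns : V.toAffine.Nonsingular e y := (Affine.equation_iff_nonsingular).mp heq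
  refine ⟨y, hns, ?_⟩
  have hneg : -(Affine.Point.some e y hns : V.toAffine.Point) = Affine.Point.some e y hns := by
    rw [Affine.Point.neg_some]
    simp only [Affine.Point.some.injEq, true_and]
    rw [Affine.negY]
    change -y - V.a₁ * e - V.a₃ = y
    linear_combination hy2
  rw [show (2 : ℤ) = ((2 : ℕ) : ℤ) from rfl, natCast_zsmul, two_nsmul]
  nth_rw 2 [← hneg]
  exact add_neg_cancel _

end TwoTorsion

/-! ## §3. [IUTchIV] Prop. 1.8 (vi), first sentence: rational `2`-torsion ⇒ a Legendre `k`-model -/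

section Descent

/-- Equal Weierstrass equations have equal `j`-invariants (whatever the ellipticity witnesses;
private plumbing for rewriting under the instance argument of `j`). [folklore] -/
private theorem j_congr {R : Type u} [CommRing R] {W₁ W₂ : WeierstrassCurve R} [W₁.IsElliptic]
    [W₂.IsElliptic] (h : W₁ = W₂) : W₁.j = W₂.j := by
  subst h
  rfl

variable {k : Type u} {Kbar : Type v} [Field k] [CharZero k] [Field Kbar] [Algebra k Kbar]
  [IsAlgClosed Kbar] (W : WeierstrassCurve k) [W.IsElliptic]

/-- Over an algebraically closed extension the `2`-division cubic has three roots, each the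
abscissa of a point of order `2`; if all points of order `2` of `W(K̄)` are `k`-rational, the three
roots lie in `k`. [cite: SilvermanAEC2009, III.2.3(d)] -/
theorem exists_roots_eq_of_two_torsion_rational
    (h2tor : ∀ T : (W.baseChange Kbar).toAffine.Point, (2 : ℤ) • T = 0 →
      T ∈ Set.range (Affine.Point.baseChange (W' := W.toAffine) k Kbar)) :
    ∃ e₁ e₂ e₃ : k, (Cubic.map (algebraMap k Kbar) W.twoTorsionPolynomial).roots =
      {algebraMap k Kbar e₁, algebraMap k Kbar e₂, algebraMap k Kbar e₃} := by
  haveI : CharZero Kbar := charZero_of_injective_algebraMap (algebraMap k Kbar).injective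
  haveI : (W.baseChange Kbar).IsElliptic := inferInstanceAs (W.map (algebraMap k Kbar)).IsElliptic
  have ha : W.twoTorsionPolynomial.a ≠ 0 := by show (4 : k) ≠ 0; norm_num
  obtain ⟨a, b, c, habc⟩ := (Cubic.splits_iff_roots_eq_three ha).mp
    (IsAlgClosed.splits (W.twoTorsionPolynomial.toPoly.map (algebraMap k Kbar)))
  -- the mapped cubic is the `2`-division cubic of `W/K̄`
  have hmap : Cubic.map (algebraMap k Kbar) W.twoTorsionPolynomial =
      (W.baseChange Kbar).twoTorsionPolynomial := by
    change _ = (W.map (algebraMap k Kbar)).twoTorsionPolynomial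
    simp only [twoTorsionPolynomial, Cubic.map, map_b₂, map_b₄, map_b₆, map_ofNat, map_mul]
  -- each root is rational
  have hrat : ∀ e ∈ (Cubic.map (algebraMap k Kbar) W.twoTorsionPolynomial).roots,
      ∃ e₀ : k, algebraMap k Kbar e₀ = e := by
    intro e he
    rw [hmap] at he
    obtain ⟨y, hns, h2⟩ := (W.baseChange Kbar).exists_two_torsion_point_of_mem_roots he
    obtain ⟨P, hP⟩ := h2tor _ h2
    rcases P with _ | ⟨e₀, y₀, h₀⟩
    · rw [← Affine.Point.zero_def, map_zero] at hP
      exact absurd hP.symm (Affine.Point.some_ne_zero _)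
    · rw [Affine.Point.map_some, Affine.Point.some.injEq] at hP
      exact ⟨e₀, hP.1⟩
  obtain ⟨e₁, he₁⟩ := hrat a (by rw [habc]; simp)
  obtain ⟨e₂, he₂⟩ := hrat b (by rw [habc]; simp)
  obtain ⟨e₃, he₃⟩ := hrat c (by rw [habc]; simp)
  exact ⟨e₁, e₂, e₃, by rw [habc, he₁, he₂, he₃]⟩

/-- **[IUTchIV] Prop. 1.8 (vi), first sentence, in real form.** Let `W` be an elliptic curve over
a field `k` of characteristic `0` all of whose points of order `2` over an algebraically closed
`K̄ ⊇ k` are `k`-rational ("the representation `G_k → Aut(E_k̄[2])` is trivial"). Then there is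
`λ ∈ k`, `λ ≠ 0, 1`, with `j(W) = j(y² = x(x − 1)(x − λ))`: the Legendre curve
`⟨0, −(1 + λ), 0, λ, 0⟩` over `k` is a `k`-model of `W_k̄` ("`E_k̄` descends to an elliptic curve
over `k` defined by means of the Legendre form"). Silverman *AEC* III.1.7.
[cite: SilvermanAEC2009, Prop. III.1.7 (proof)] -/
theorem exists_legendre_j_eq_of_two_torsion_rational
    (h2tor : ∀ T : (W.baseChange Kbar).toAffine.Point, (2 : ℤ) • T = 0 →
      T ∈ Set.range (Affine.Point.baseChange (W' := W.toAffine) k Kbar)) :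
    ∃ la : k, la ≠ 0 ∧ la ≠ 1 ∧
      ∃ _ : (⟨0, -(1 + la), 0, la, 0⟩ : WeierstrassCurve k).IsElliptic,
        W.j = (⟨0, -(1 + la), 0, la, 0⟩ : WeierstrassCurve k).j := by
  haveI : CharZero Kbar := charZero_of_injective_algebraMap (algebraMap k Kbar).injective
  obtain ⟨e₁, e₂, e₃, h3⟩ := W.exists_roots_eq_of_two_torsion_rational h2tor
  obtain ⟨hla0, hla1, hV, hj⟩ := W.algebraMap_j_eq_legendre_j_of_roots_eq h3
  set φ := algebraMap k Kbar with hφ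
  set la : k := (e₃ - e₁) / (e₂ - e₁) with hla
  have hlaφ : (φ e₃ - φ e₁) / (φ e₂ - φ e₁) = φ la := by rw [hla, map_div₀, map_sub, map_sub]
  have hla0' : la ≠ 0 := fun h => hla0 (by rw [hlaφ, h, map_zero])
  have hla1' : la ≠ 1 := fun h => hla1 (by rw [hlaφ, h, map_one])
  have h2 : (2 : k) ≠ 0 := two_ne_zero
  haveI hVk : (⟨0, -(1 + la), 0, la, 0⟩ : WeierstrassCurve k).IsElliptic :=
    (legendre_isElliptic_iff h2 la).mpr ⟨hla0', hla1'⟩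
  refine ⟨la, hla0', hla1', hVk, φ.injective ?_⟩
  -- the Legendre curve of `φλ` over `K̄` is the base change of the Legendre curve of `λ` over `k`
  have hcurve : (⟨0, -(1 + (φ e₃ - φ e₁) / (φ e₂ - φ e₁)), 0, (φ e₃ - φ e₁) / (φ e₂ - φ e₁), 0⟩ :
      WeierstrassCurve Kbar) = (⟨0, -(1 + la), 0, la, 0⟩ : WeierstrassCurve k).map φ := by
    rw [hlaφ]
    ext <;> simp [WeierstrassCurve.map]
  rw [hj, j_congr hcurve, map_j]
end Descent

end WeierstrassCurve
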